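import Summits.QuantumFields.YangMills.Theorems.BalabanUVNodesN16AveragingPin
import Summits.QuantumFields.BalabanUV.T4Continuum.Support.NE7EtaMinimiserGaugeCovariance
import Literature.MathematicalPhysics.QuantumFieldTheory.Balaban1983to89.B7Prop6Flat
import HarnessLib

/-!
# YM-DAG node N16 (NE3), the located averaging pin (42) ↔ (0.4) — part 12: THE AVERAGING TRANSFER IS A THEOREM FOR EVERY GAUGE-COVARIANT
# SCHEME THAT IS POINTWISE COARSE-GAUGE EQUIVALENT TO (43); the criterion, its non-vacuity, and its verdict for (0.4) vs (42) from parts 1–11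

Cell `pub-ymgap`, width seat `pub-ymgap-dag-n16-w3` (director-ym №197 ∕ HUMAN RULING D-0149), generation 6; part 12 of the W1b lineage (g0 `…N16AveragingPin`:
the pin as DISPLAYED transfer hypotheses; g2∕g5 parts 1–11: the first-order anatomy of (42) ↔ (0.4)).  `--supports stmt-QuantumFields-20544 --as helper` (K3⁷;
count-neutral).  `bears_on: R4∕N16`.

THE POINT.  g0 typed the pin as `N16AveragingPin.AveragingTransfer N s F := H7Body N step42 F → H7Body N s F` — [Balaban1987RG1] p. 253∕254's universality
CLAIM for [Balaban1985Variational] Thm 1 (8)+(9), displayed, asserted for no scheme `s` (dag-n16-e `LOCATED-NE3-PIN-AVERAGING.md` R3: «comparison theorem between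
(42)- and (0.4)-constrained minimisers — NOT IN PRINT»).  Parts 1–11 anatomised the DIFFERENCE of the two averaging MAPS, never the two VARIATIONAL PROBLEMS.  Here:
 * §1 `minimiser_transfer` (abstract): constraint maps `A, B : X → Y` whose fibres over EVERY datum are exchanged by cost- and class-preserving self-maps
   `Φ, Ψ` (`A ∘ Φ = B`, `B ∘ Ψ = A` on the class) have corresponding constrained minimisers AT THE SAME DATUM.
 * §4 `ExactGaugeDefect d s L N k C` — THE CRITERION for a depth-indexed scheme `s` (g0's `avgIterS s k`) against Bałaban's (43) (`avgIter L · k`) on a class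
   `C`: (cov) `s` is GAUGE-COVARIANT on `C`, the datum moving by the corner values ((11)∕(45)-TYPE, `avgIterS s k (U^u) = (avgIterS s k U)^{ū}`, `ū = uLev L u k`,
   unitary `(N·L^k)`-periodic `u`); (defect) POINTWISE COARSE-GAUGE EQUIVALENCE: every `U ∈ C` has a unitary `N`-periodic coarse gauge `κ_U` with
   `avgIterS s k U = (avgIter L U k)^{κ_U}` — `κ_U` may depend on `U` in any way.  Non-vacuity: (42)∕(43) meets it with `κ = 1` (`exactGaugeDefect_step42`;
   (45) for (43) is the tree's UNCONDITIONAL `B7Prop6Flat.avgIter_gaugeAct_units`).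
 * §4 ★★ `exists_isMinimiser_gaugeAct_of_isMinimiserS` ∕ ★★ `exists_isMinimiserS_gaugeAct_of_isMinimiser`: under the criterion on a gauge-invariant class, every
   `s`-constrained minimiser at datum `V` (`IsMinimiserS`) is carried BY A DATA-DEPENDENT FINE GAUGE (the block lift `x ↦ κ_U(⌊x∕L^k⌋)^{±1}`, §2) to a
   (43)-constrained minimiser (`MinimalActionSandwich.IsMinimiser`) AT THE SAME DATUM, and conversely — competitors are pulled across by their OWN `κ_{U′}`, so no
   covariance of `U ↦ κ_U` is needed; the level action is gauge invariant (`NE7EtaMinimiserGaugeCovariance.levelAction_gaugeAct`).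
 * §3 `regularSup_gaugeAct`: `RegularSup` is gauge invariant under unitary periodic gauges with NO smallness side condition (flux covariance through the
   UNCONDITIONAL series-logarithm conjugation `B7Prop6Flat.mlog_conj`).
 * §5 ★ `leafH3supS_iff`: under the criterion at every depth `k+1` on the small-field classes, `LeafH3supS d s` IS `LeafH3sup`; ★★ `averagingTransfer_of_exactGaugeDefect`:
   **`AveragingTransfer N s F` HOLDS** for every scheme meeting the criterion on `sfClass 4 F.L (2L^m) ε₁ (k+1)`, some `ε₁ > 0`, all `k` (and conversely).

VERDICT FOR THE PIN — v1.1 (DOCSTRING-ONLY edition; every declaration byte-identical to v1.0 p612224; CORRECTED by part 13 `…N16Eq04SameBlocksBasePointGauge`).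
v1.0 said here «the CENTRING half of (0.4) FAILS (defect) at first order (`ι_sF`, parts 6–10), so the transfer cannot come from gauge bookkeeping» — WRONG
GEOMETRY: parts 6–10 compare (42) with the stencil over the SHIFTED block `q − s + [0,L)ᵈ` at the same anchor (two different partitions).  The record's (0.4)
(`Setup.blockOf = ⌊·∕L⌋`, base point `Setup.emb` = block CENTRE, `AveragingRT.axialAvg`) lives on the SAME partition as the fold's (42) and only moves the BASE POINT
(plus symmetrised stars and the inner mean); for THAT comparison part 13 proves `T04_s − Tside = Λ_s(q) − Λ_s(q+Le_κ)` EXACTLY (linearised, any field, any offset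
`s`, no curvature hypothesis) and, for abelian `W = e^A`, `e^{T04} = e^{Λ(q)}·V̄_c·(e^{Λ(q+Le_κ)})⁻¹` with equal coarse plaquettes; the tree's NE7 torus instance of (42)
already reads the base-point move non-abelianly and exactly as conjugation by the data-dependent centre-to-corner transports (`QLaTorusB7Averaging.cstep`).  SO the
whole one-step pin meets (defect) EXACTLY at the linearised∕abelian level; what keeps g0's `Transfer04to42 ∕ 42to04` from being an instance of
`averagingTransfer_of_exactGaugeDefect` is (i) NON-ABELIAN SECOND-ORDER content (`2ρ₂`, parts 3∕5∕9∕11), (ii) the iteration (43), (iii) `step04`'s divergences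
(d1)–(d3) — not a first-order non-gauge term.  The transfers are NOT obtained here; criterion and theorems unchanged.

HONEST FRAMING.  [folklore] bookkeeping BY NAME over g0's `N16AveragingPin`, pub-balaban's `NE7EtaMinimiserGaugeCovariance`, `NE3ResidualSliceRep`, `AveragingDeficitKDatum`,
`BlockAverageCurrent`, `AveragingDeficitTransport`, lit-balaban's `B7Prop6Flat`; ONE Prop-valued structure (the criterion), 0 `sorry`, no `instance`, no `notation`; no
minimiser constructed; no printed sentence is a hypothesis; nothing of [Balaban1985Variational] ∕ [Balaban1987RG1] asserted; `stub_h7` (RETIRED by (β16)) NOT revived; K3⁷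
stubs NOT touched; N16 ∕ NE3 NOT discharged; count-neutral (typed 28∕28 · discharged 5∕27 work-bound, A 5∕28 — unmoved).  One finite four-torus programme at fixed `ε` —
the Yang–Mills mass gap (Clay) is NOT proved by any of this; R4 closes the conditional finite-𝕋⁴ rung `BalabanLadder.UV` only; nothing continuum ∕ ℝ⁴ ∕ OS.
-/

set_option autoImplicit false

open scoped BigOperators Matrix Matrix.Norms.L2Operator
open NormedSpace

namespace Summit.QuantumFields.YangMills.BalabanUVNodes.N16AveragingTransferOfGaugeDefect

open Literature.MathematicalPhysics.QuantumFieldTheory.Balaban1983to89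
open Literature.MathematicalPhysics.QuantumFieldTheory.Balaban1983to89.T4Continuum (T4Family)
open B7Prop1Explicit B7Prop2Explicit MatrixLog
open B7AvgGaugeCovariance (uLev uLev_apply)
open B7Prop6Flat (avgIter_gaugeAct_units mlog_conj)
open T4AveragingDeficitWall (fhol Ad flux covGrad IsUnitaryCfg SmallField)
open T4AveragingDeficitWallBoundary (IsPeriodicCfg)
open T4AveragingDeficitNonAbelian (Ad_mul Ad_sub)
open Summit.QuantumFields.BalabanUV.T4Continuum
open MinimalActionLevels (levelAction)
open MinimalActionSandwich (admissible IsMinimiser)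
open MinimalActionRate (sfClass SmallField.mono)
open MinimalActionRefine (RegularSup)
open NE3.LeafIndexSockets (LeafH3sup)
open NE3EnergyShapes (IsUnitarySite IsPeriodicSite)
open NE3ResidualSliceRep (mem_sfClass_gaugeAct isPeriodicCfg_gaugeAct)
open AveragingDeficitKDatum (gaugeAct_inv_gaugeAct isUnitaryCfg_gaugeAct fhol_gaugeAct)
open AveragingDeficitTransport (norm_Ad_of_unitary)
open BlockAverageCurrent (smallField_gaugeAct)
open NE7EtaMinimiserGaugeCovariance (levelAction_gaugeAct isUnitarySite_inv isPeriodicSite_inv)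
open Summit.QuantumFields.YangMills.BalabanUVNodes.N16AveragingPin
  (avgIterS step42 avgIterS_step42 admissibleS IsMinimiserS LeafH3supS leafH3supS_step42_iff H7Body AveragingTransfer)
open Node00 (MatA ne3NperOfRecord₁₁ ne3DomOfRecord₁₁)

noncomputable section

/-! ## §1 The abstract transfer principle: constraint maps with exchangeable fibres have corresponding minimisers -/

section Abstract

variable {X Y : Type*}

/-- **THE TRANSFER PRINCIPLE (abstract).**  Constraint maps `A, B : X → Y`, a class `C ⊆ X`, a cost `S : X → ℝ`, and self-maps `Φ, Ψ` of `X`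
preserving `C` and `S` with `A (Φ x) = B x`, `B (Ψ x) = A x` on `C` (the fibre of `B` over ANY datum is carried into the fibre of `A` over the same
datum by `Φ`, and back by `Ψ`): a `B`-constrained minimiser `x` at datum `y` is carried by `Φ` to an `A`-constrained minimiser at the SAME datum — every
`A`-competitor `x′` is beaten through its own partner `Ψ x′`.  No relation between `Φ` and `Ψ` is needed. [folklore] -/
theorem minimiser_transfer (A B : X → Y) (C : Set X) (S : X → ℝ) (Φ Ψ : X → X)
    (hΦC : ∀ x ∈ C, Φ x ∈ C) (hΨC : ∀ x ∈ C, Ψ x ∈ C) (hΦS : ∀ x ∈ C, S (Φ x) = S x) (hΨS : ∀ x ∈ C, S (Ψ x) = S x)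
    (hAΦ : ∀ x ∈ C, A (Φ x) = B x) (hBΨ : ∀ x ∈ C, B (Ψ x) = A x)
    {y : Y} {x : X} (hxC : x ∈ C) (hxB : B x = y) (hmin : ∀ x' ∈ C, B x' = y → S x ≤ S x') :
    Φ x ∈ C ∧ A (Φ x) = y ∧ ∀ x' ∈ C, A x' = y → S (Φ x) ≤ S x' := by
  refine ⟨hΦC x hxC, by rw [hAΦ x hxC, hxB], fun x' hx'C hx'A => ?_⟩
  rw [hΦS x hxC, ← hΨS x' hx'C]
  exact hmin (Ψ x') (hΨC x' hx'C) (by rw [hBΨ x' hx'C, hx'A])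

end Abstract

/-! ## §2 The block lift of a coarse gauge function: a fine gauge with prescribed corner values -/

section BlockLift

variable {d : ℕ} {n : Type*} [Fintype n] [DecidableEq n]

/-- The fine site function `x ↦ κ(⌊x∕L^k⌋)` (coordinatewise integer division) has CORNER VALUES `κ`: `uLev L (·) k = κ` (`1 ≤ L`). [folklore] -/
theorem uLev_blockLift {G : Type*} (L : ℕ) (hL : 1 ≤ L) (k : ℕ) (κ : Site d → G) :
    uLev L (fun x : Site d => κ (fun i => x i / (L : ℤ) ^ k)) k = κ := by
  have hLk : ((L : ℤ) ^ k) ≠ 0 := pow_ne_zero _ (by exact_mod_cast (by omega : L ≠ 0))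
  funext z
  simp only [uLev_apply]
  congr 1
  funext i
  rw [Pi.smul_apply, smul_eq_mul, Int.mul_ediv_cancel_left _ hLk]

/-- The block lift of a unitary-valued coarse gauge is unitary-valued. [folklore] -/
theorem isUnitarySite_blockLift {κ : Site d → (Matrix n n ℂ)ˣ} (hκ : IsUnitarySite κ) (M : ℤ) :
    IsUnitarySite (fun x : Site d => κ (fun i => x i / M)) :=
  fun _ => hκ _

/-- The block lift of an `N`-periodic coarse gauge at scale `L^k` is `(N·L^k)`-periodic: `⌊(x + N L^k e_i)∕L^k⌋ = ⌊x∕L^k⌋ + N e_i`. [folklore] -/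
theorem isPeriodicSite_blockLift (L : ℕ) (hL : 1 ≤ L) (k : ℕ) {N : ℕ} {κ : Site d → (Matrix n n ℂ)ˣ}
    (hκ : IsPeriodicSite κ (N : ℤ)) :
    IsPeriodicSite (fun x : Site d => κ (fun i => x i / (L : ℤ) ^ k)) ((N * L ^ k : ℕ) : ℤ) := by
  have hLk : ((L : ℤ) ^ k) ≠ 0 := pow_ne_zero _ (by exact_mod_cast (by omega : L ≠ 0))
  intro x i
  have hfun : (fun j : Fin d => (x + ((N * L ^ k : ℕ) : ℤ) • e i) j / (L : ℤ) ^ k)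
      = (fun j : Fin d => x j / (L : ℤ) ^ k) + (N : ℤ) • e i := by
    funext j
    simp only [Pi.add_apply, Pi.smul_apply, smul_eq_mul, e, Pi.single_apply]
    split_ifs with hj
    · rw [mul_one, mul_one, Nat.cast_mul, Nat.cast_pow, Int.add_mul_ediv_right _ _ hLk]
    · rw [mul_zero, mul_zero, add_zero, add_zero]
  show κ (fun j : Fin d => (x + ((N * L ^ k : ℕ) : ℤ) • e i) j / (L : ℤ) ^ k) = κ (fun j : Fin d => x j / (L : ℤ) ^ k)
  rw [hfun, hκ]

end BlockLift

/-! ## §3 Gauge invariance of the Theorem-1 regularity reading `RegularSup`, with no smallness side condition -/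

section Regular

variable {d : ℕ} {n : Type*} [Fintype n] [DecidableEq n] [Nonempty n]

omit [Nonempty n] in
/-- **THE FLUX IS GAUGE-COVARIANT FOR EVERY INVERTIBLE GAUGE FUNCTION, with no domain condition**: `F^u(p) = Ad_{u(z)} F(p)` (the series
logarithm (21) is conjugation-covariant unconditionally, `B7Prop6Flat.mlog_conj`; the tree's `AveragingDeficitKDatum.flux_gaugeAct` is the
unitary case inside the analyticity domain). [cite: Balaban1985Averaging, (21)–(22) p.21, p.24] -/
theorem flux_gaugeAct_units (u : Site d → (Matrix n n ℂ)ˣ) (V : Site d → Fin d → (Matrix n n ℂ)ˣ) (p : T4AveragingDeficitWall.Plaq d) :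
    flux (gaugeAct u V) p = Ad (u p.1) (flux V p) := by
  unfold flux Ad
  rw [fhol_gaugeAct, Units.val_mul, Units.val_mul]
  exact mlog_conj (u p.1) _

omit [Nonempty n] in
/-- **THE COVARIANT FLUX GRADIENT IS GAUGE-COVARIANT, unconditionally**: `(∇_{V^u} F^u)(x,κ;π) = Ad_{u(x)} (∇_V F)(x,κ;π)`. [folklore] -/
theorem covGrad_flux_gaugeAct_units (u : Site d → (Matrix n n ℂ)ˣ) (V : Site d → Fin d → (Matrix n n ℂ)ˣ) (x : Site d) (κ : Fin d)
    (π : T4AveragingDeficitWall.Plane d) :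
    covGrad (gaugeAct u V) (flux (gaugeAct u V)) x κ π = Ad (u x) (covGrad V (flux V) x κ π) := by
  unfold covGrad
  rw [flux_gaugeAct_units, flux_gaugeAct_units, Ad_sub]
  change Ad (u x * V x κ * (u (x + e κ))⁻¹) (Ad (u (x + e κ)) (flux V (x + e κ, π))) - Ad (u x) (flux V (x, π)) = _
  rw [← Ad_mul, inv_mul_cancel_right, Ad_mul]

/-- **`RegularSup` IS GAUGE INVARIANT** under unitary `(N·L^j)`-periodic gauge functions: `U(N)`-valuedness, periodicity, the small-field radius
and the pointwise covariant flux-gradient bound are all kept (`‖Ad_u X‖ = ‖X‖` for unitary `u`).  No smallness of the radius is needed. [folklore] -/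
theorem regularSup_gaugeAct {L N : ℕ} {b c : ℝ} {j : ℕ} {u : Site d → (Matrix n n ℂ)ˣ} (hu : IsUnitarySite u)
    (huP : IsPeriodicSite u ((N * L ^ j : ℕ) : ℤ)) {U : Site d → Fin d → (Matrix n n ℂ)ˣ} (h : RegularSup d L N b c j U) :
    RegularSup d L N b c j (gaugeAct u U) where
  unitary := isUnitaryCfg_gaugeAct hu h.unitary
  periodic := isPeriodicCfg_gaugeAct huP h.periodic
  small := smallField_gaugeAct hu h.small
  grad x κ π := by
    rw [covGrad_flux_gaugeAct_units, norm_Ad_of_unitary (hu x)]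
    exact h.grad x κ π

/-- … and back: `RegularSup` of `U^u` gives `RegularSup` of `U` (apply the inverse gauge). [folklore] -/
theorem regularSup_of_regularSup_gaugeAct {L N : ℕ} {b c : ℝ} {j : ℕ} {u : Site d → (Matrix n n ℂ)ˣ} (hu : IsUnitarySite u)
    (huP : IsPeriodicSite u ((N * L ^ j : ℕ) : ℤ)) {U : Site d → Fin d → (Matrix n n ℂ)ˣ} (h : RegularSup d L N b c j (gaugeAct u U)) :
    RegularSup d L N b c j U := by
  have h' := regularSup_gaugeAct (isUnitarySite_inv hu) (isPeriodicSite_inv huP) h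
  rwa [gaugeAct_inv_gaugeAct] at h'

end Regular

/-! ## §4 The criterion `ExactGaugeDefect` and the correspondence of constrained minimisers at the same datum -/

section Criterion

variable {d : ℕ} {n : Type*} [Fintype n] [DecidableEq n]

variable (d) in
/-- **THE CRITERION: an exact, pointwise coarse-gauge defect of the scheme `s` against Bałaban's (43) at depth `k` on the class `C`.**
(cov) the scheme's `k`-fold average is GAUGE-COVARIANT on `C`, the datum moving by the corner values `ū = uLev L u k` of a unitary `(N·L^k)`-periodic
`u` (the (11) p. 19 ∕ (45) p. 24 TYPE of [Balaban1985Averaging]; (43) has it unconditionally, `B7Prop6Flat.avgIter_gaugeAct_units`; (0.4) has it on the torus,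
`BlockAveraging.avgFun_covariant`); (defect) POINTWISE COARSE-GAUGE EQUIVALENCE to (43): every `U ∈ C` has a unitary `N`-periodic coarse gauge `κ_U` with
`avgIterS s k U = (avgIter L U k)^{κ_U}` — `κ_U` may depend on `U` in any way.  A hypothesis SHAPE; asserted here only for (42)∕(43) itself. [folklore] -/
@[folklore]
structure ExactGaugeDefect (s : ℕ → (Site d → Fin d → (Matrix n n ℂ)ˣ) → (Site d → Fin d → (Matrix n n ℂ)ˣ)) (L N k : ℕ)
    (C : Set (Site d → Fin d → (Matrix n n ℂ)ˣ)) : Prop where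
  /-- (cov) the scheme is gauge-covariant on `C`, the datum moving by the corner values `ū = uLev L u k` -/
  cov : ∀ (u : Site d → (Matrix n n ℂ)ˣ) (U : Site d → Fin d → (Matrix n n ℂ)ˣ), IsUnitarySite u →
    IsPeriodicSite u ((N * L ^ k : ℕ) : ℤ) → U ∈ C → avgIterS s k (gaugeAct u U) = gaugeAct (uLev L u k) (avgIterS s k U)
  /-- (defect) on `C` the scheme's `k`-fold average is a (configuration-dependent) unitary `N`-periodic coarse gauge transform of (43)'s -/
  defect : ∀ U ∈ C, ∃ κ : Site d → (Matrix n n ℂ)ˣ, IsUnitarySite κ ∧ IsPeriodicSite κ (N : ℤ) ∧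
    avgIterS s k U = gaugeAct κ (avgIter L U k)

/-- The criterion restricts to sub-classes. [folklore] -/
theorem ExactGaugeDefect.of_subset {s : ℕ → (Site d → Fin d → (Matrix n n ℂ)ˣ) → (Site d → Fin d → (Matrix n n ℂ)ˣ)} {L N k : ℕ}
    {C C' : Set (Site d → Fin d → (Matrix n n ℂ)ˣ)} (h : ExactGaugeDefect d s L N k C) (hC' : C' ⊆ C) : ExactGaugeDefect d s L N k C' where
  cov u U hu huP hU := h.cov u U hu huP (hC' hU)
  defect U hU := h.defect U (hC' hU)

/-- **NON-VACUITY: (42)∕(43) meets the criterion against itself with the trivial gauge `κ = 1`** on every class, at every depth (covariance is the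
tree's unconditional (45), `B7Prop6Flat.avgIter_gaugeAct_units`, read through g0's dictionary `avgIterS_step42`). [folklore] -/
theorem exactGaugeDefect_step42 (L N k : ℕ) (C : Set (Site d → Fin d → (Matrix n n ℂ)ˣ)) :
    ExactGaugeDefect d (fun _ => step42 L) L N k C where
  cov u U _ _ _ := by rw [avgIterS_step42, avgIterS_step42, avgIter_gaugeAct_units]
  defect U _ := by
    refine ⟨fun _ => 1, fun _ => (unitaryUnits (Matrix n n ℂ)).one_mem, fun _ _ => rfl, ?_⟩
    rw [avgIterS_step42]
    funext x μ
    simp only [gaugeAct, one_mul, inv_one, mul_one]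

variable {s : ℕ → (Site d → Fin d → (Matrix n n ℂ)ˣ) → (Site d → Fin d → (Matrix n n ℂ)ˣ)}
  {𝒞 : ℕ → Set (Site d → Fin d → (Matrix n n ℂ)ˣ)} {L N k : ℕ}

/-- **★★ AN `s`-CONSTRAINED MINIMISER IS A GAUGE TRANSFORM OF A (43)-CONSTRAINED MINIMISER AT THE SAME DATUM.**  On a class `𝒞 k` invariant under
unitary `(N·L^k)`-periodic gauges where `s` meets the criterion: if `U` minimises the level-`k` action over the `s`-admissible configurations of datum `V`
(g0's `IsMinimiserS`), then `U^u` — `u` the block lift of `κ_U`, unitary `(N·L^k)`-periodic — minimises it over the (43)-admissible ones of the SAME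
datum (`IsMinimiser`): `avgIter L (U^u) k = (avgIter L U k)^{κ_U} = avgIterS s k U = V` by (45), and a (43)-competitor `U′` is matched by the `s`-competitor
`U′^{lift κ_{U′}⁻¹}` of equal action ((cov) then (defect) at `U′`).  §1 with `Φ U = U^{lift κ_U}`, `Ψ U = U^{lift κ_U⁻¹}`. [folklore] -/
theorem exists_isMinimiser_gaugeAct_of_isMinimiserS (hL : 1 ≤ L)
    (hC : ∀ (u : Site d → (Matrix n n ℂ)ˣ) (U : Site d → Fin d → (Matrix n n ℂ)ˣ), IsUnitarySite u →
      IsPeriodicSite u ((N * L ^ k : ℕ) : ℤ) → U ∈ 𝒞 k → gaugeAct u U ∈ 𝒞 k)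
    (hE : ExactGaugeDefect d s L N k (𝒞 k)) {V U : Site d → Fin d → (Matrix n n ℂ)ˣ} (hU : IsMinimiserS d s 𝒞 L N k V U) :
    ∃ u : Site d → (Matrix n n ℂ)ˣ, IsUnitarySite u ∧ IsPeriodicSite u ((N * L ^ k : ℕ) : ℤ) ∧
      IsMinimiser d 𝒞 L N k V (gaugeAct u U) := by
  classical
  choose! κ hκu hκP hκdef using hE.defect
  -- the block lifts of `κ_U` and of `κ_U⁻¹`
  set lift : (Site d → Fin d → (Matrix n n ℂ)ˣ) → Site d → (Matrix n n ℂ)ˣ :=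
    fun U x => κ U (fun i => x i / (L : ℤ) ^ k) with hlift
  set liftInv : (Site d → Fin d → (Matrix n n ℂ)ˣ) → Site d → (Matrix n n ℂ)ˣ :=
    fun U x => (κ U (fun i => x i / (L : ℤ) ^ k))⁻¹ with hliftInv
  have hlu : ∀ U ∈ 𝒞 k, IsUnitarySite (lift U) := fun U hU => isUnitarySite_blockLift (hκu U hU) _
  have hlP : ∀ U ∈ 𝒞 k, IsPeriodicSite (lift U) ((N * L ^ k : ℕ) : ℤ) := fun U hU =>
    isPeriodicSite_blockLift L hL k (hκP U hU)
  have hliu : ∀ U ∈ 𝒞 k, IsUnitarySite (liftInv U) := fun U hU => isUnitarySite_inv (hlu U hU)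
  have hliP : ∀ U ∈ 𝒞 k, IsPeriodicSite (liftInv U) ((N * L ^ k : ℕ) : ℤ) := fun U hU => isPeriodicSite_inv (hlP U hU)
  have hcorner : ∀ U, uLev L (lift U) k = κ U := fun U => uLev_blockLift L hL k (κ U)
  have hcornerInv : ∀ U, uLev L (liftInv U) k = fun w => (κ U w)⁻¹ := fun U =>
    uLev_blockLift L hL k (fun w => (κ U w)⁻¹)
  obtain ⟨hUC, hUV⟩ := hU.mem
  have main := minimiser_transfer (fun W => avgIter L W k) (avgIterS s k) (𝒞 k) (levelAction d L N k)
    (fun W => gaugeAct (lift W) W) (fun W => gaugeAct (liftInv W) W)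
    (fun W hW => hC _ _ (hlu W hW) (hlP W hW) hW) (fun W hW => hC _ _ (hliu W hW) (hliP W hW) hW)
    (fun W _ => levelAction_gaugeAct L N k _ W) (fun W _ => levelAction_gaugeAct L N k _ W)
    (fun W hW => by
      show avgIter L (gaugeAct (lift W) W) k = avgIterS s k W
      rw [avgIter_gaugeAct_units, hcorner, hκdef W hW])
    (fun W hW => by
      show avgIterS s k (gaugeAct (liftInv W) W) = avgIter L W k
      rw [hE.cov _ _ (hliu W hW) (hliP W hW) hW, hcornerInv, hκdef W hW, gaugeAct_inv_gaugeAct])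
    hUC hUV (fun U' hU'C hU'V => hU.le U' ⟨hU'C, hU'V⟩)
  obtain ⟨h1, h2, h3⟩ := main
  exact ⟨lift U, hlu U hUC, hlP U hUC, ⟨h1, h2⟩, fun U' hU' => h3 U' hU'.1 hU'.2⟩

/-- **★★ CONVERSELY, A (43)-CONSTRAINED MINIMISER IS A GAUGE TRANSFORM OF AN `s`-CONSTRAINED MINIMISER AT THE SAME DATUM** (the block lift of
`κ_U⁻¹` carries it across; §1's principle with the roles of the two constraint maps exchanged). [folklore] -/
theorem exists_isMinimiserS_gaugeAct_of_isMinimiser (hL : 1 ≤ L)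
    (hC : ∀ (u : Site d → (Matrix n n ℂ)ˣ) (U : Site d → Fin d → (Matrix n n ℂ)ˣ), IsUnitarySite u →
      IsPeriodicSite u ((N * L ^ k : ℕ) : ℤ) → U ∈ 𝒞 k → gaugeAct u U ∈ 𝒞 k)
    (hE : ExactGaugeDefect d s L N k (𝒞 k)) {V U : Site d → Fin d → (Matrix n n ℂ)ˣ} (hU : IsMinimiser d 𝒞 L N k V U) :
    ∃ u : Site d → (Matrix n n ℂ)ˣ, IsUnitarySite u ∧ IsPeriodicSite u ((N * L ^ k : ℕ) : ℤ) ∧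
      IsMinimiserS d s 𝒞 L N k V (gaugeAct u U) := by
  classical
  choose! κ hκu hκP hκdef using hE.defect
  set lift : (Site d → Fin d → (Matrix n n ℂ)ˣ) → Site d → (Matrix n n ℂ)ˣ :=
    fun U x => κ U (fun i => x i / (L : ℤ) ^ k) with hlift
  set liftInv : (Site d → Fin d → (Matrix n n ℂ)ˣ) → Site d → (Matrix n n ℂ)ˣ :=
    fun U x => (κ U (fun i => x i / (L : ℤ) ^ k))⁻¹ with hliftInv
  have hlu : ∀ U ∈ 𝒞 k, IsUnitarySite (lift U) := fun U hU => isUnitarySite_blockLift (hκu U hU) _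
  have hlP : ∀ U ∈ 𝒞 k, IsPeriodicSite (lift U) ((N * L ^ k : ℕ) : ℤ) := fun U hU =>
    isPeriodicSite_blockLift L hL k (hκP U hU)
  have hliu : ∀ U ∈ 𝒞 k, IsUnitarySite (liftInv U) := fun U hU => isUnitarySite_inv (hlu U hU)
  have hliP : ∀ U ∈ 𝒞 k, IsPeriodicSite (liftInv U) ((N * L ^ k : ℕ) : ℤ) := fun U hU => isPeriodicSite_inv (hlP U hU)
  have hcorner : ∀ U, uLev L (lift U) k = κ U := fun U => uLev_blockLift L hL k (κ U)
  have hcornerInv : ∀ U, uLev L (liftInv U) k = fun w => (κ U w)⁻¹ := fun U =>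
    uLev_blockLift L hL k (fun w => (κ U w)⁻¹)
  obtain ⟨hUC, hUV⟩ := hU.mem
  have main := minimiser_transfer (avgIterS s k) (fun W => avgIter L W k) (𝒞 k) (levelAction d L N k)
    (fun W => gaugeAct (liftInv W) W) (fun W => gaugeAct (lift W) W)
    (fun W hW => hC _ _ (hliu W hW) (hliP W hW) hW) (fun W hW => hC _ _ (hlu W hW) (hlP W hW) hW)
    (fun W _ => levelAction_gaugeAct L N k _ W) (fun W _ => levelAction_gaugeAct L N k _ W)
    (fun W hW => by
      show avgIterS s k (gaugeAct (liftInv W) W) = avgIter L W k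
      rw [hE.cov _ _ (hliu W hW) (hliP W hW) hW, hcornerInv, hκdef W hW, gaugeAct_inv_gaugeAct])
    (fun W hW => by
      show avgIter L (gaugeAct (lift W) W) k = avgIterS s k W
      rw [avgIter_gaugeAct_units, hcorner, hκdef W hW])
    hUC hUV (fun U' hU'C hU'V => hU.le U' ⟨hU'C, hU'V⟩)
  obtain ⟨h1, h2, h3⟩ := main
  exact ⟨liftInv U, hliu U hUC, hliP U hUC, ⟨h1, h2⟩, fun U' hU' => h3 U' hU'.1 hU'.2⟩

end Criterion

/-! ## §5 The Theorem-1 leaves agree; the averaging transfer for schemes meeting the criterion -/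

section Leaves

variable {d : ℕ} {n : Type*} [Fintype n] [DecidableEq n] [Nonempty n]
variable {s : ℕ → (Site d → Fin d → (Matrix n n ℂ)ˣ) → (Site d → Fin d → (Matrix n n ℂ)ˣ)} {L N : ℕ} {ε b c : ℝ}
  {dom : Set (Site d → Fin d → (Matrix n n ℂ)ˣ)}

/-- **★ THE (43)-LEAF GIVES THE `s`-LEAF**: if `s` meets the criterion at every depth `k+1` on `sfClass d L N ε (k+1)` (itself gauge invariant,
`mem_sfClass_gaugeAct`), the tree's Theorem-1 leaf `LeafH3sup d L N ε b c dom` yields g0's `LeafH3supS d s L N ε b c dom`: transport the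
`s`-minimiser to a (43)-minimiser at the same datum (§4), read its `RegularSup`, gauge back (§3). [folklore] -/
theorem leafH3supS_of_leafH3sup (hL : 1 ≤ L) (hE : ∀ k : ℕ, ExactGaugeDefect d s L N (k + 1) (sfClass d L N ε (k + 1)))
    (h : LeafH3sup d L N ε b c dom) : LeafH3supS d s L N ε b c dom := by
  intro V hV k U hU
  obtain ⟨u, hu, huP, hmin⟩ := exists_isMinimiser_gaugeAct_of_isMinimiserS (𝒞 := sfClass d L N ε) hL
    (fun u U hu huP hU => mem_sfClass_gaugeAct hu huP hU) (hE k) hU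
  exact regularSup_of_regularSup_gaugeAct hu huP (h V hV k _ hmin)

/-- **★ THE `s`-LEAF GIVES THE (43)-LEAF** (same criterion; the converse transport of §4). [folklore] -/
theorem leafH3sup_of_leafH3supS (hL : 1 ≤ L) (hE : ∀ k : ℕ, ExactGaugeDefect d s L N (k + 1) (sfClass d L N ε (k + 1)))
    (h : LeafH3supS d s L N ε b c dom) : LeafH3sup d L N ε b c dom := by
  intro V hV k U hU
  obtain ⟨u, hu, huP, hmin⟩ := exists_isMinimiserS_gaugeAct_of_isMinimiser (𝒞 := sfClass d L N ε) hL
    (fun u U hu huP hU => mem_sfClass_gaugeAct hu huP hU) (hE k) hU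
  exact regularSup_of_regularSup_gaugeAct hu huP (h V hV k _ hmin)

/-- **THE TWO LEAVES ARE EQUIVALENT** for every scheme meeting the criterion at all depths on the small-field classes. [folklore] -/
theorem leafH3supS_iff (hL : 1 ≤ L) (hE : ∀ k : ℕ, ExactGaugeDefect d s L N (k + 1) (sfClass d L N ε (k + 1))) :
    LeafH3supS d s L N ε b c dom ↔ LeafH3sup d L N ε b c dom :=
  ⟨leafH3sup_of_leafH3supS hL hE, leafH3supS_of_leafH3sup hL hE⟩

omit [Nonempty n] in
/-- The small-field classes are monotone in the radius, so the criterion at radius `ε₁` gives it at every `ε ≤ ε₁`. [folklore] -/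
theorem exactGaugeDefect_sfClass_of_le {k : ℕ} {ε ε₁ : ℝ} (hε : ε ≤ ε₁)
    (h : ExactGaugeDefect d s L N k (sfClass d L N ε₁ k)) : ExactGaugeDefect d s L N k (sfClass d L N ε k) :=
  h.of_subset fun _ hU => ⟨hU.1, hU.2.1, SmallField.mono hU.2.2 (div_le_div_of_nonneg_right hε (by positivity))⟩

end Leaves

section Pin

variable (N : ℕ) [NeZero N]

/-- **★★ THE AVERAGING TRANSFER (g0's `N16AveragingPin.AveragingTransfer N s F`, displayed there, asserted for no scheme) HOLDS FOR EVERY SCHEME `s`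
MEETING THE CRITERION** against (43) at every depth `k+1` on N16's classes `sfClass 4 F.L (2L^m) ε₁ (k+1)` for SOME `ε₁ > 0`: the (42)-side body
`H7Body N step42 F` (= `stub_h7 F` verbatim, `h7Body_step42_iff`) implies `H7Body N s F` (`ε₀ ↦ min ε₀ ε₁`, same `C`).  What the criterion does NOT
cover is exactly the pin's non-gauge content (header VERDICT). [folklore] -/
theorem averagingTransfer_of_exactGaugeDefect (F : T4Family)
    (s : ℕ → ((Fin 4 → ℤ) → Fin 4 → (MatA N)ˣ) → ((Fin 4 → ℤ) → Fin 4 → (MatA N)ˣ)) {ε₁ : ℝ} (hε₁ : 0 < ε₁)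
    (hE : ∀ k : ℕ, ExactGaugeDefect 4 s F.L (ne3NperOfRecord₁₁ F 0 0) (k + 1)
      (sfClass 4 F.L (ne3NperOfRecord₁₁ F 0 0) ε₁ (k + 1))) :
    AveragingTransfer N s F := by
  haveI : Nonempty (Fin N) := ⟨0⟩
  rintro ⟨C, ε₀, hC, hε₀, h⟩
  refine ⟨C, min ε₀ ε₁, hC, lt_min hε₀ hε₁, fun ε hε hεle => ?_⟩
  have h42 := h ε hε (hεle.trans (min_le_left _ _))
  rw [leafH3supS_step42_iff] at h42
  exact leafH3supS_of_leafH3sup F.hL.2.le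
    (fun k => exactGaugeDefect_sfClass_of_le (hεle.trans (min_le_right _ _)) (hE k)) h42

/-- **THE CONVERSE TRANSFER**: under the same criterion the `s`-side body gives the (42)-side body (`stub_h7 F`'s statement, displayed as the
conclusion `H7Body N step42 F`; nothing is asserted about either side). [folklore] -/
theorem h7Body_step42_of_h7Body (F : T4Family)
    (s : ℕ → ((Fin 4 → ℤ) → Fin 4 → (MatA N)ˣ) → ((Fin 4 → ℤ) → Fin 4 → (MatA N)ˣ)) {ε₁ : ℝ} (hε₁ : 0 < ε₁)
    (hE : ∀ k : ℕ, ExactGaugeDefect 4 s F.L (ne3NperOfRecord₁₁ F 0 0) (k + 1)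
      (sfClass 4 F.L (ne3NperOfRecord₁₁ F 0 0) ε₁ (k + 1)))
    (hs : H7Body N s F) : H7Body N (fun _ => step42 F.L) F := by
  haveI : Nonempty (Fin N) := ⟨0⟩
  obtain ⟨C, ε₀, hC, hε₀, h⟩ := hs
  refine ⟨C, min ε₀ ε₁, hC, lt_min hε₀ hε₁, fun ε hε hεle => ?_⟩
  rw [leafH3supS_step42_iff]
  exact leafH3sup_of_leafH3supS F.hL.2.le
    (fun k => exactGaugeDefect_sfClass_of_le (hεle.trans (min_le_right _ _)) (hE k)) (h ε hε (hεle.trans (min_le_left _ _)))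

/-- **HENCE THE TWO BODIES ARE EQUIVALENT** for every scheme meeting the criterion (bookkeeping of the two directions). [folklore] -/
theorem h7Body_iff_of_exactGaugeDefect (F : T4Family)
    (s : ℕ → ((Fin 4 → ℤ) → Fin 4 → (MatA N)ˣ) → ((Fin 4 → ℤ) → Fin 4 → (MatA N)ˣ)) {ε₁ : ℝ} (hε₁ : 0 < ε₁)
    (hE : ∀ k : ℕ, ExactGaugeDefect 4 s F.L (ne3NperOfRecord₁₁ F 0 0) (k + 1)
      (sfClass 4 F.L (ne3NperOfRecord₁₁ F 0 0) ε₁ (k + 1))) :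
    H7Body N s F ↔ H7Body N (fun _ => step42 F.L) F :=
  ⟨h7Body_step42_of_h7Body N F s hε₁ hE, averagingTransfer_of_exactGaugeDefect N F s hε₁ hE⟩

end Pin

end

end Summit.QuantumFields.YangMills.BalabanUVNodes.N16AveragingTransferOfGaugeDefect
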